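import Summits.HodgeConjecture.HodgeConjecture.Theorems.F3DualAbelianSchemeStubZ   -- T0 (Z) closer `…F3DualAbelianScheme.stub_F3Z_holds` (F0P1c-p04 (g0), (Z) chain)
import Summits.HodgeConjecture.HodgeConjecture.Theorems.F3DualAbelianSchemeStubK   -- ★ p792729 (K) closer `…F3DualAbelianScheme.stub_F3K_holds` (B-p08 (g15))
import Summits.HodgeConjecture.HodgeConjecture.Theorems.F3DualAbelianSchemeStubM   -- T3 (M) closer `…F3DualAbelianScheme.stub_F3M_holds` (bytes B-p10 (g14), filer B-p11 (g21))
import Literature.AlgebraicGeometry.AbelianSchemes.ProjectiveAbelianSchemeAmpleClass   -- ★ p788891 (L) `AbelianSchemeOver.exists_affine_rigidified_fibrewise_ample_of_isProjective` (B-p12 (g18))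
import Literature.AlgebraicGeometry.AbelianSchemes.AbelianSchemeDualPair
import Literature.AlgebraicGeometry.Morphisms.ProjectiveMorphism
import Literature.AlgebraicGeometry.Morphisms.ProjectiveMorphismComposition
import Mathlib.RingTheory.HopkinsLevitzki
import HarnessLib

/-!
# F-3 sub-line `Cruxes/HDel/Lines/F3DualAbelianScheme` — THE PARENT HEAD `stub_F3` AS AN IMPORTABLE THEOREM (T4), and its Artin slice (F-11 α2′)

Summit `HodgeConjecture`, sub-problem `HodgeConjecture` (crux item `stmt-HodgeConjecture-24835`, HDel), namespace
`Summit.HodgeConjecture.CorCM.Cruxes.HypDel.F3DualAbelianScheme` (the registered F-3 sub-line's).  Crux workfiles under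
`Cruxes/…/Lines` are not built on the farm, so the parent line's PROVED glue (ed. 1.4 §5–§7: [MumfordFogartyKirwan1994, Ch. 6 §1
Cor. 6.8] in print form and the registry letter `stub_F3`) is RE-HOMED here, by import over the four closed letters — (Z)
`stub_F3Z_holds` (`Theorems/F3DualAbelianSchemeStubZ`), (L) ★ `AbelianSchemeOver.exists_affine_rigidified_fibrewise_ample_of_isProjective`,
(K) `stub_F3K_holds` (`Theorems/F3DualAbelianSchemeStubK`), (M) `stub_F3M_holds` (`Theorems/F3DualAbelianSchemeStubM`) — so that every
consumer takes the F-3 head BY ONE NAME: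

* `F3Closure.dualPair_of_isProjective` — [MFK94, Cor. 6.8] in print form: a PROJECTIVE abelian scheme over a locally noetherian
  `ℚ`-scheme has a ★ `DualPair` (parent §5, verbatim);
* `F3Closure.isProjective_baseChange_of_isBaseChangeVia` — the chart lemma (parent §6, verbatim);
* `stub_F3_holds` — the registry-24835 letter `stub_F3` TOKEN FOR TOKEN (parent §7 proof, verbatim), consumed by the P1 head line
  `Cruxes/HDel/Lines/F0_SiegelModuli.lean`;
* `F11SmoothRoadA.stub_dualPairOfLift_holds` — the ARTIN SLICE: the letter α2′ `stub_dualPairOfLift` of the F-11 sub-line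
  `Cruxes/HDel/Lines/F11SmoothRoadA.lean` (ED. 2‴ :121–124) TOKEN FOR TOKEN — an abelian scheme over an Artinian local `ℚ`-algebra `A`
  with `X → Spec A` projective has a dual pair — which is `dualPair_of_isProjective` at `S = Spec A` (Artinian ⇒ Noetherian ⇒
  `Spec A` locally noetherian, Mathlib); the relative-dimension binder of the letter is idle.

0 new mathematics beyond the 3-line Artin specialisation; 0 `def`; statements of the two closed letters are byte-identical to the
registered ones.  Cell `hodgecm-mathlib` (D-0151); glue authors B-typ01 (g17) (menu §3–§4) ∕ B-plan1 (g19) (parent pen); re-homing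
F0P1c-p06 (g2).  HC_CM is proved only modulo the 7 printed citations until rung 0 closes; this file discharges none of them (it makes
the F-3 letter of the P1 line under HDel, already closed letter by letter, importable).
-/

noncomputable section

open CategoryTheory CategoryTheory.Limits AlgebraicGeometry
open Literature.AlgebraicGeometry.AbelianSchemes Literature.AlgebraicGeometry.Motives
  Literature.AlgebraicGeometry.AbelianVarieties Literature.AlgebraicGeometry.Modules
open Literature.AlgebraicGeometry.Morphisms (IsProjective)

namespace Summit.HodgeConjecture.CorCM.Cruxes.HypDel.F3DualAbelianScheme

namespace F3Closure

/-- **Chart lemma (parent §6, re-homed)**: if `G : B → A` over `i : U → S` exhibits `B` as a base change of `A`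
(★ `AbelianSchemeOver.IsBaseChangeVia`: cartesian square of group schemes) and `B → U` is projective, then the CHOSEN base change
`A.baseChange i → U` (= `pullback.snd`) is projective: `pullback.snd = e⁻¹ ≫ (B → U)` for the comparison isomorphism
`e : B ≅ A ×_S U` of the cartesian square, and an isomorphism is a closed immersion.
[cite: Hartshorne1977, II §4 Definition p.103 (projective morphism)] -/
theorem isProjective_baseChange_of_isBaseChangeVia {S U : Scheme.{0}} {A : AbelianSchemeOver S} {i : U ⟶ S}
    {B : AbelianSchemeOver U} {G : B.X.left ⟶ A.X.left} (h : B.IsBaseChangeVia A i G) (hB : IsProjective B.X.hom) :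
    IsProjective (A.baseChange i).X.hom := by
  obtain ⟨-, hpb, -, -⟩ := h
  have e : pullback.snd A.X.hom i = hpb.isoPullback.inv ≫ B.X.hom :=
    (Iso.eq_inv_comp _).2 hpb.isoPullback_hom_snd
  rw [AbelianSchemeOver.baseChange_hom, e]
  exact hB.comp_isClosedImmersion _

/-- **[MumfordFogartyKirwan1994, Ch. 6 §1 Corollary 6.8 (p. 118)] in print form (parent §5, re-homed)**: a PROJECTIVE abelian
scheme over a locally noetherian `ℚ`-scheme has a dual pair — cover `S` by the connected Noetherian affine charts of (L) (a Mathlib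
`Scheme.Cover.mkOfCovers` indexed by the points of `S`) carrying a rigidified rank-one `L` fibrewise of ample class; on each chart
(K) makes `K(L)` finite étale and (M) (Mumford's `Â := A ⁄ K(L)`) produces the dual pair of `A ×_S Spec R`; (Z) glues.
Projectivity of `Â` is not asserted (no consumer).
[cite: MumfordFogartyKirwan1994, Ch. 6 §1 Corollary 6.8 (p. 118) and §2 (p. 121)] [cite: MumfordAV1970, §13 Theorem (p. 125)] -/
theorem dualPair_of_isProjective ⦃S : Scheme.{0}⦄ [IsLocallyNoetherian S] (fS : S ⟶ Spec (.of ℚ)) (A : AbelianSchemeOver S)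
    (hA : IsProjective A.X.hom) : Nonempty A.DualPair := by
  classical
  choose R iR iN iQ iC i hi hs L hL h using
    Literature.AlgebraicGeometry.AbelianSchemes.AbelianSchemeOver.exists_affine_rigidified_fibrewise_ample_of_isProjective fS A hA
  let 𝒰 : S.OpenCover :=
    Scheme.Cover.mkOfCovers (P := @IsOpenImmersion) S _ i
      (fun s => ⟨s, (hs s).choose, (hs s).choose_spec⟩) hi
  refine stub_F3Z_holds A 𝒰 fun s => ?_
  exact (@stub_F3M_holds (R s) (iR s) (iN s) (iQ s) (iC s) (A.baseChange (i s))
    (by rw [AbelianSchemeOver.baseChange_hom]; exact hA.pullback_snd (i s)) (L s) (hL s) (h s).1 (h s).2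
    (@stub_F3K_holds (R s) (iR s) (iN s) (iQ s) (A.baseChange (i s)) (L s) (hL s) (h s).1 (h s).2)).some

end F3Closure

/-- **HEAD `stub_F3` PROVED, importable** = letter (L) «dual pairs Zariski-locally of projective abelian schemes» of registry 24835
v5.5-C (= binder `hF3` of ★ `exists_threshold_siegelFineModuliScheme_of_cores'`; = `stub_F3` of `Cruxes/HDel/Lines/F3DualAbelianScheme.lean`
ed. 1.4 :220–223 and of the P1 head `Cruxes/HDel/Lines/F0_SiegelModuli.lean`, TOKEN FOR TOKEN): over a locally noetherian `ℚ`-scheme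
`S`, an abelian scheme that is Zariski-locally on `S` a base change of a PROJECTIVE abelian scheme has a dual pair — index an open
cover of `S` by its points using the charts of the hypothesis; on the chart at `s`, `A.baseChange (i s)` is projective
(`F3Closure.isProjective_baseChange_of_isBaseChangeVia`), `U s` is locally noetherian (Mathlib `isLocallyNoetherian_of_isOpenImmersion`),
so `F3Closure.dualPair_of_isProjective` gives its dual pair; (Z) `stub_F3Z_holds` glues (parent §7 proof, verbatim).
[cite: MumfordFogartyKirwan1994, Ch. 6 §1 Corollary 6.8 (p. 118)] [cite: Lan2013PELCompactifications, Thm. 1.3.2.3 (p. 70)] -/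
theorem stub_F3_holds : ∀ ⦃S : Scheme.{0}⦄ [IsLocallyNoetherian S] (_fS : S ⟶ Spec (.of ℚ)) (A : AbelianSchemeOver S),
    (∀ s : S, ∃ (U : Scheme.{0}) (i : U ⟶ S) (_ : IsOpenImmersion i) (_ : s ∈ Set.range i.base)
      (B : AbelianSchemeOver U) (G : B.X.left ⟶ A.X.left), B.IsBaseChangeVia A i G ∧ IsProjective B.X.hom) →
    Nonempty A.DualPair := by
  intro S _ fS A hL
  choose U i hi hs B G hBG hproj using hL
  let 𝒰 : S.OpenCover :=
    Scheme.Cover.mkOfCovers (P := @IsOpenImmersion) S U i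
      (fun s => ⟨s, (hs s).choose, (hs s).choose_spec⟩) hi
  refine stub_F3Z_holds A 𝒰 fun s => ?_
  haveI : IsOpenImmersion (i s) := hi s
  haveI : IsLocallyNoetherian (U s) := isLocallyNoetherian_of_isOpenImmersion (i s)
  exact (F3Closure.dualPair_of_isProjective (i s ≫ fS) (A.baseChange (i s))
    (F3Closure.isProjective_baseChange_of_isBaseChangeVia (hBG s) (hproj s))).some

end Summit.HodgeConjecture.CorCM.Cruxes.HypDel.F3DualAbelianScheme

/-! ## The Artin slice — F-11 sub-line `Cruxes/HDel/Lines/F11SmoothRoadA.lean`, letter α2′ `stub_dualPairOfLift`, CLOSED -/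

namespace Summit.HodgeConjecture.CorCM.Cruxes.HypDel.F11SmoothRoadA

/-- **stub F-3 (Artin slice) `stub_dualPairOfLift` PROVED** — the letter α2′ of `Cruxes/HDel/Lines/F11SmoothRoadA.lean` (ED. 2‴
:121–124) TOKEN FOR TOKEN: an abelian scheme `X` over an Artinian local `ℚ`-algebra `A` with `X → Spec A` projective has a dual pair
([MumfordFogartyKirwan1994] Ch. 6 §1 Cor. 6.8: `Pic^τ(X/S) = X̂` exists and is an abelian scheme, with its Poincaré sheaf).  Proof:
`A` Artinian ⇒ Noetherian (Hopkins, Mathlib) ⇒ `Spec A` locally noetherian (Mathlib), and `Spec A → Spec ℚ` is the structure map, so this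
is `F3DualAbelianScheme.F3Closure.dualPair_of_isProjective`; the relative-dimension hypothesis is not used.  The F-11 line folds
`stub_dualPairOfLift := stub_dualPairOfLift_holds` by `exact` at its next edition.
[cite: MumfordFogartyKirwan1994, Ch. 6 §1 Cor. 6.8 (p. 118)] -/
theorem stub_dualPairOfLift_holds (g : ℕ) :
    ∀ (A : Type) [CommRing A] [Algebra ℚ A] [IsArtinianRing A] [IsLocalRing A] (X : AbelianSchemeOver (Spec (.of A))),
      X.IsOfRelDim g → IsProjective X.X.hom → Nonempty X.DualPair := by
  intro A _ _ _ _ X _ hX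
  exact F3DualAbelianScheme.F3Closure.dualPair_of_isProjective (Spec.map (CommRingCat.ofHom (algebraMap ℚ A))) X hX

end Summit.HodgeConjecture.CorCM.Cruxes.HypDel.F11SmoothRoadA

end
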